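import Summits.KontsevichZagierPeriods.KontsevichZagierPeriods.Theorems.SoloInformedReflectRadical
import Summits.KontsevichZagierPeriods.KontsevichZagierPeriods.Theorems.SoloInformedPowSubst
import Summits.KontsevichZagierPeriods.KontsevichZagierPeriods.Theorems.SoloInformedKZExamplePi
import HarnessLib
import HarnessLib.Audit

/-!
# SoloInformed — the one-variable elementary class: `K(x)`, `K(x^{1/m})`, `K(x, √q)` on natural domains

Solo programme `solo-KontsevichZagierPeriods-informed`, session s112, file 32 (capstone of the
dimension-`1` line, files 451–475).

Two last pieces of bookkeeping and one statement.  (i) The circle type `√(α² − (x − β)²)` on the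
CLOSED root interval `[β − α, β + α]`: split at `x = β` and reflect the left half by `x = 2β − v`
(`soloInformed_segSpan_of_sqrtQuadratic_circClosed`).  (ii) The class
`SoloInformedIsKSqrtQuadNaturalOne`: `(A + B√q)/C`, `A, B, C ∈ K[X]`, `C ≠ 0` on `D`, `q` a quadratic
over `K` in normal form with its NATURAL domain (`(x−β)²+α²`: any `D`; `α²−(x−β)²`: `D ⊆ [β−α, β+α]`;
`(x−β)²−α²`: `D ⊆ {|x − β| ≥ α}`).  (iii) The elementary class `SoloInformedIsKElementaryOne` =
`K`-rational ∪ `K(x^{1/m})` (`D ⊆ [0,∞)`) ∪ the uniformised quadratic-radical classes ∪ (ii), and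

**THEOREM (`soloInformed_kzp_elementaryOne`).  Let `K = ℝ ∩ ℚ̄`.  If two absolutely convergent
integrals `∫_D f`, `∫_{D'} f'` of dimension `1` (`D, D'` arbitrary `ℚ`-semialgebraic sets) have
integrands in the elementary class and equal values, they are equivalent under the Kontsevich–Zagier
rules (additivity, algebraic change of variables, Newton–Leibniz); likewise against rational
representations of dimension `≤ 1` and against every member of the span of points and segments
(e.g. the area representations of file 21).**  Unconditional, kernel-checked.

References: M. Kontsevich, D. Zagier, *Periods* (2001), §1.1–1.2 (Question 1); A. Baker,
*Transcendental Number Theory* (1975), Thm. 2.1; Bochnak–Coste–Roy (1998), §2.2.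
-/

noncomputable section

open scoped BigOperators Polynomial

namespace Summit.KontsevichZagierPeriods.KontsevichZagierPeriods.Theorems

open Set MeasureTheory
open Literature.ModelTheory.ExponentialFields
open Literature.NumberTheory.Transcendental Literature.NumberTheory.Transcendental.KZ

/-! ## The circle type on the closed root interval -/

/-- Left half `[β − α, β]` of the circle type, by the reflection `x = 2β − v`. -/
theorem soloInformed_segSpan_of_sqrtQuadratic_circLeft (r : IntegralRep 1) (α β : algebraicClosure ℚ ℝ)
    (A B C : (algebraicClosure ℚ ℝ)[X]) (hα : 0 < algebraMap _ ℝ α)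
    (hC : ∀ x ∈ r.domain, (Polynomial.aeval (x 0) C : ℝ) ≠ 0)
    (hD : ∀ x ∈ r.domain, algebraMap _ ℝ β - algebraMap _ ℝ α ≤ x 0 ∧ x 0 ≤ algebraMap _ ℝ β)
    (hf : EqOn r.integrand (fun x => ((Polynomial.aeval (x 0) A : ℝ) + Polynomial.aeval (x 0) B *
      Real.sqrt ((algebraMap _ ℝ α) ^ 2 - (x 0 - algebraMap _ ℝ β) ^ 2)) /
      Polynomial.aeval (x 0) C) r.domain) :
    of r ∈ soloInformedSegSpan := by
  have hne : algebraMap (algebraicClosure ℚ ℝ) ℝ (-1) ≠ 0 := by rw [map_neg, map_one]; norm_num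
  obtain ⟨R', hdom, hint, hrel⟩ := soloInformed_exists_affineSubst (-1) (β + β) hne r
  refine soloInformed_segSpan_of_subst hrel (soloInformed_segSpan_of_isKSqrtQuadraticOne R' ?_)
  have hpt : ∀ u : Fin 1 → ℝ, soloInformedScaleMoveR 0 (algebraMap (algebraicClosure ℚ ℝ) ℝ (β + β))
      (algebraMap (algebraicClosure ℚ ℝ) ℝ (-1)) u 0 =
      algebraMap _ ℝ β + algebraMap _ ℝ β - u 0 := fun u => by
    rw [(soloInformed_affine_apply _ _ u).1, map_add, map_neg, map_one]; ring
  have hdet : |(soloInformedScaleDerivR (n := 1) 0 (algebraMap (algebraicClosure ℚ ℝ) ℝ (-1))).det| = 1 := by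
    rw [(soloInformed_affine_apply (algebraMap (algebraicClosure ℚ ℝ) ℝ (-1))
      (algebraMap (algebraicClosure ℚ ℝ) ℝ (β + β)) 0).2, map_neg, map_one, abs_neg, abs_one]
  have hmem : ∀ u ∈ R'.domain, soloInformedScaleMoveR 0 (algebraMap (algebraicClosure ℚ ℝ) ℝ (β + β))
      (algebraMap (algebraicClosure ℚ ℝ) ℝ (-1)) u ∈ r.domain := fun u hu => by
    rw [hdom] at hu; exact hu.2
  have hcomp : ∀ (P : (algebraicClosure ℚ ℝ)[X]) (u : ℝ),
      (Polynomial.aeval u (soloInformedAffComp (-1) (β + β) P) : ℝ) =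
        Polynomial.aeval (algebraMap _ ℝ β + algebraMap _ ℝ β - u) P := fun P u => by
    rw [soloInformed_aeval_affComp, map_add, map_neg, map_one]; ring_nf
  refine ⟨α, β, soloInformedAffComp (-1) (β + β) A, soloInformedAffComp (-1) (β + β) B,
    soloInformedAffComp (-1) (β + β) C, hα, fun u hu => ?_,
    Or.inr (Or.inl ⟨fun u hu => ?_, fun u hu => ?_⟩)⟩
  · rw [hcomp, ← hpt u]
    exact hC _ (hmem u hu)
  · obtain ⟨h1, h2⟩ := hD _ (hmem u hu)
    rw [hpt] at h1 h2
    constructor <;> linarith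
  · rw [hint]
    show r.integrand _ * _ = _
    rw [hdet, mul_one, hf (hmem u hu)]
    show ((Polynomial.aeval (soloInformedScaleMoveR 0 _ _ u 0) A : ℝ) +
        Polynomial.aeval (soloInformedScaleMoveR 0 _ _ u 0) B *
          Real.sqrt ((algebraMap _ ℝ α) ^ 2 - (soloInformedScaleMoveR 0 _ _ u 0 - algebraMap _ ℝ β) ^ 2)) /
        Polynomial.aeval (soloInformedScaleMoveR 0 _ _ u 0) C =
      ((Polynomial.aeval (u 0) (soloInformedAffComp (-1) (β + β) A) : ℝ) +
        Polynomial.aeval (u 0) (soloInformedAffComp (-1) (β + β) B) *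
          Real.sqrt ((algebraMap _ ℝ α) ^ 2 - (u 0 - algebraMap _ ℝ β) ^ 2)) /
        Polynomial.aeval (u 0) (soloInformedAffComp (-1) (β + β) C)
    have hs : (algebraMap (algebraicClosure ℚ ℝ) ℝ β + algebraMap _ ℝ β - u 0 - algebraMap _ ℝ β) ^ 2 =
        (u 0 - algebraMap (algebraicClosure ℚ ℝ) ℝ β) ^ 2 := by ring
    rw [hpt u, hcomp, hcomp, hcomp, hs]

/-- **Circle type on the closed root interval:** `(A + B√(α² − (x − β)²))/C` on any
`D ⊆ [β − α, β + α]` lies in the span (split at `x = β`; reflect the left half). -/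
theorem soloInformed_segSpan_of_sqrtQuadratic_circClosed (r : IntegralRep 1)
    (α β : algebraicClosure ℚ ℝ) (A B C : (algebraicClosure ℚ ℝ)[X]) (hα : 0 < algebraMap _ ℝ α)
    (hC : ∀ x ∈ r.domain, (Polynomial.aeval (x 0) C : ℝ) ≠ 0)
    (hD : ∀ x ∈ r.domain, algebraMap _ ℝ β - algebraMap _ ℝ α ≤ x 0 ∧
      x 0 ≤ algebraMap _ ℝ β + algebraMap _ ℝ α)
    (hf : EqOn r.integrand (fun x => ((Polynomial.aeval (x 0) A : ℝ) + Polynomial.aeval (x 0) B *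
      Real.sqrt ((algebraMap _ ℝ α) ^ 2 - (x 0 - algebraMap _ ℝ β) ^ 2)) /
      Polynomial.aeval (x 0) C) r.domain) :
    of r ∈ soloInformedSegSpan := by
  have hK := soloInformed_isAlgebraic_algebraMap_K
  set S : Set (Fin 1 → ℝ) := {x | x ∈ r.domain ∧ x 0 ≤ algebraMap _ ℝ β} with hSdef
  set T : Set (Fin 1 → ℝ) := {x | x ∈ r.domain ∧ algebraMap _ ℝ β < x 0} with hTdef
  have hS : IsSemialgebraic ℚ S := by
    have h := (soloInformed_isSemialgebraicFunOn_aevalK hK r.isSemialgebraic_domain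
      (MvPolynomial.C β - MvPolynomial.X 0 : MvPolynomial (Fin 1) (algebraicClosure ℚ ℝ))).isSemialgebraic_sep_nonneg
    convert h using 2 with x
    simp [sub_nonneg]
  have hT : IsSemialgebraic ℚ T := by
    have h := (soloInformed_isSemialgebraicFunOn_aevalK hK r.isSemialgebraic_domain
      (MvPolynomial.C β - MvPolynomial.X 0 : MvPolynomial (Fin 1) (algebraicClosure ℚ ℝ))).isSemialgebraic_sep_neg
    convert h using 2 with x
    simp [sub_neg]
  refine soloInformed_segSpan_of_two_pieces r S T hS hT (fun x hx => hx.1) (fun x hx => hx.1)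
    (fun x hx => ?_) ?_ ?_ ?_
  · rcases le_or_gt (x 0) (algebraMap (algebraicClosure ℚ ℝ) ℝ β) with h | h
    · exact Or.inl ⟨hx, h⟩
    · exact Or.inr ⟨hx, h⟩
  · refine Set.eq_empty_iff_forall_notMem.2 fun x hx => ?_
    have h1 := hx.1.2
    have h2 := hx.2.2
    linarith
  · exact soloInformed_segSpan_of_sqrtQuadratic_circLeft _ α β A B C hα (fun x hx => hC x hx.1)
      (fun x hx => ⟨(hD x hx.1).1, hx.2⟩) fun x hx => hf hx.1
  · refine soloInformed_segSpan_of_isKSqrtQuadraticOne _ ⟨α, β, A, B, C, hα, fun x hx => hC x hx.1,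
      Or.inr (Or.inl ⟨fun x hx => ⟨?_, (hD x hx.1).2⟩, fun x hx => hf hx.1⟩)⟩
    have h := hx.2
    linarith

/-! ## Quadratic radicals on natural domains; the elementary class -/

/-- `(A + B√q)/C` with `q` a quadratic over `K` in normal form on its natural domain:
`(x − β)² + α²` (any `D`), `α² − (x − β)²` (`D ⊆ [β − α, β + α]`), `(x − β)² − α²`
(`D ⊆ {|x − β| ≥ α}`); `α > 0`, `C ≠ 0` on `D`. -/
def SoloInformedIsKSqrtQuadNaturalOne (r : IntegralRep 1) : Prop :=
  ∃ (α β : algebraicClosure ℚ ℝ) (A B C : (algebraicClosure ℚ ℝ)[X]),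
    0 < algebraMap _ ℝ α ∧ (∀ x ∈ r.domain, (Polynomial.aeval (x 0) C : ℝ) ≠ 0) ∧
    ( EqOn r.integrand (fun x => ((Polynomial.aeval (x 0) A : ℝ) + Polynomial.aeval (x 0) B *
          Real.sqrt ((x 0 - algebraMap _ ℝ β) ^ 2 + (algebraMap _ ℝ α) ^ 2)) /
          Polynomial.aeval (x 0) C) r.domain ∨
      ((∀ x ∈ r.domain, algebraMap _ ℝ β - algebraMap _ ℝ α ≤ x 0 ∧
          x 0 ≤ algebraMap _ ℝ β + algebraMap _ ℝ α) ∧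
        EqOn r.integrand (fun x => ((Polynomial.aeval (x 0) A : ℝ) + Polynomial.aeval (x 0) B *
          Real.sqrt ((algebraMap _ ℝ α) ^ 2 - (x 0 - algebraMap _ ℝ β) ^ 2)) /
          Polynomial.aeval (x 0) C) r.domain) ∨
      ((∀ x ∈ r.domain, x 0 ≤ algebraMap _ ℝ β - algebraMap _ ℝ α ∨
          algebraMap _ ℝ β + algebraMap _ ℝ α ≤ x 0) ∧
        EqOn r.integrand (fun x => ((Polynomial.aeval (x 0) A : ℝ) + Polynomial.aeval (x 0) B *
          Real.sqrt ((x 0 - algebraMap _ ℝ β) ^ 2 - (algebraMap _ ℝ α) ^ 2)) /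
          Polynomial.aeval (x 0) C) r.domain) )

/-- Members of the natural-domain quadratic-radical class lie in the span. -/
theorem soloInformed_segSpan_of_isKSqrtQuadNaturalOne (r : IntegralRep 1)
    (hr : SoloInformedIsKSqrtQuadNaturalOne r) : of r ∈ soloInformedSegSpan := by
  obtain ⟨α, β, A, B, C, hα, hC, h | ⟨hD, hf⟩ | ⟨hD, hf⟩⟩ := hr
  · exact soloInformed_segSpan_of_isKSqrtQuadraticOne r ⟨α, β, A, B, C, hα, hC, Or.inl h⟩
  · exact soloInformed_segSpan_of_sqrtQuadratic_circClosed r α β A B C hα hC hD hf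
  · exact soloInformed_segSpan_of_sqrtQuadratic_twoSided r α β A B C hα hC hD hf

/-- **The elementary class** (dimension `1`, coefficients in `K = ℝ ∩ ℚ̄`, arbitrary
`ℚ`-semialgebraic domain `D`): integrand on `D` of one of the forms `P(x)/Q(x)`;
`P(x^{1/m})/Q(x^{1/m})` (`m ≥ 1`, `D ⊆ [0, ∞)`); rational in the uniformising parameter of
`√(1 − x²)`, `√(1 + x²)`, `√(x² − 1)`; `(A + B√q)/C` with `q` a `K`-quadratic in normal form on its
natural domain. -/
def SoloInformedIsKElementaryOne (r : IntegralRep 1) : Prop :=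
  SoloInformedIsKRationalOne r ∨ (∃ m : ℕ, m ≠ 0 ∧ SoloInformedIsKRadicalOne m r) ∨
    SoloInformedIsKQuadRadicalOne r ∨ SoloInformedIsKSqrtQuadNaturalOne r

/-- Every elementary representation lies in the span of points and segments. -/
theorem soloInformed_segSpan_of_isKElementaryOne (r : IntegralRep 1)
    (hr : SoloInformedIsKElementaryOne r) : of r ∈ soloInformedSegSpan := by
  rcases hr with h | ⟨m, hm, h⟩ | h | h
  · exact soloInformed_segSpan_of_isKRationalOne r h
  · exact soloInformed_segSpan_of_isKRadicalOne hm r h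
  · exact soloInformed_segSpan_of_isKQuadRadicalOne r h
  · exact soloInformed_segSpan_of_isKSqrtQuadNaturalOne r h

/-- **The Kontsevich–Zagier period conjecture on the one-variable elementary class.**  For
`r, r'` of dimension `1` with elementary integrands (`SoloInformedIsKElementaryOne`):
`value r = value r' → Equivalent r r'`; and `r` is equivalent to every rational representation of
dimension `≤ 1` and to every member of the span of points and segments with the same value.
Unconditional. [Kontsevich–Zagier 2001, §1.2 Question 1; Baker 1975, Thm. 2.1; this work] -/
theorem soloInformed_kzp_elementaryOne (r r' : IntegralRep 1) (hr : SoloInformedIsKElementaryOne r)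
    (hr' : SoloInformedIsKElementaryOne r') :
    (r.value = r'.value → Equivalent r r') ∧
    (∀ {n : ℕ} (hn : n ≤ 1) (r₀ : IntegralRep n), r₀.IsRational → r.value = r₀.value →
      Equivalent r r₀) ∧
    (∀ {m : ℕ} (r₂ : IntegralRep m), of r₂ ∈ soloInformedSegSpan → r.value = r₂.value →
      Equivalent r r₂) := by
  have h := soloInformed_segSpan_of_isKElementaryOne r hr
  exact ⟨fun hv => soloInformed_equivalent_of_mem_segSpan h
      (soloInformed_segSpan_of_isKElementaryOne r' hr') hv,
    fun hn r₀ hr₀ hv => soloInformed_equivalent_of_mem_segSpan h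
      (soloInformed_of_mem_segSpan_of_isRational hn r₀ hr₀) hv,
    fun r₂ hr₂ hv => soloInformed_equivalent_of_mem_segSpan h hr₂ hv⟩

/-- **Kernel form:** an elementary representation of value `0` is a relation, `[r] ∈ relations`
— i.e. `∫_D f = 0` is "provable by the three rules". -/
theorem soloInformed_mem_relations_of_value_eq_zero_elementaryOne (r : IntegralRep 1)
    (hr : SoloInformedIsKElementaryOne r) (h0 : r.value = 0) : of r ∈ relations :=
  soloInformed_mem_relations_of_mem_segSpan (soloInformed_segSpan_of_isKElementaryOne r hr)
    (by rw [eval_of]; exact h0)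

/-- The example of file 28 is elementary: `[(−1,1), 2√(1 − x²)]`. -/
theorem soloInformed_isKElementaryOne_piRepSqrt : SoloInformedIsKElementaryOne soloInformedPiRepSqrt :=
  Or.inr (Or.inr (Or.inl (Or.inl soloInformed_isKCircleOne_piRepSqrt)))

end Summit.KontsevichZagierPeriods.KontsevichZagierPeriods.Theorems
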